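import Summits.ResolutionOfSingularities.ResolutionOfSingularities.Theorems.EquisingularLiftEquisingularLiftNatP1VBCechTransfer
import Literature.AlgebraicGeometry.Morphisms.CechModuleSheafHom
import Literature.AlgebraicGeometry.Modules.SheafHomLeft
import Literature.AlgebraicGeometry.Modules.AffineLocalizingClosure
import HarnessLib

/-!
# [OURS · L1 W4.5(b) · T-P1VB part 9] `𝓗om(L, L) ≅ 𝒪` for a line bundle, and the `Ȟ¹` transfer on `ℙ¹_k`:
# `0 → L → C → Q → 0`, `Ȟ¹(𝓗om(L, Q)) = 0 ⇒ Ȟ¹(𝓗om(L, C)) = 0`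

Cell res-hironaka, LADDER-RESOLUTION rung L (D-0089), slot W4.5(b), crux `Theses.EquisingularLift.EquisingularLiftNat`
(stmt-ResolutionOfSingularities-20038) / child `EquisingularLiftNatThree` (stmt-ResolutionOfSingularities-20148); object **T-P1VB**
(res-L1-w45b-lead-2 BOOK 2026-08-27T09:28:20Z; supplier debt (b) of `Theorems/…NatDirZeroDefs.lean`: from `DirStepUnobs`-type vanishing
`Ȟ¹(𝓗om(K₀, 𝒞_k/K₀)) = 0` to the lift hypothesis `Ȟ¹(𝓗om(K₀, 𝒞_k)) = 0`), `--supports stmt-ResolutionOfSingularities-20148 --as helper`.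
NOT a statement of any manuscript; OURS. AI-written; AI review is weaker than expert review.

WHAT.
* `isBasis_frameOpens`, **`isIso_sheafHomUnit_of_lineBundle`** — for `L` free of rank one near every point (any scheme), the unit
  `𝒪_X → 𝓗om(L, L)`, `a ↦ a·𝟙` (tree `Modules.sheafHomUnit`) is an ISOMORPHISM (bijective on the basis of framed opens: on a frame
  `b`, `χ ↦` the coordinate of `χ(b)`; tree `IsoOfSectionsOnBasis.isIso_of_bijective_on_basis`);
  `isAffineLocalizing_sheafHom_self_of_lineBundle`;
* `subsingleton_cechMH1_sheafHom_self_projectiveLine` — `Ȟ¹((D₊x₀,D₊x₁); 𝓗om(L,L)) = 0` on `ℙ¹_k` (part 8 + the iso);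
* `subsingleton_cechMH1_of_cechExactData` — two-out-of-three for `Ȟ¹ = 0` from the tree's `CechExactData`;
* **`subsingleton_cechMH1_sheafHom_of_shortExact_projectiveLine`** — `S : 0 → L → C → Q → 0` short exact on `ℙ¹_k`, `L` a line
  bundle: `Ȟ¹((D₊x₀,D₊x₁); 𝓗om(L, Q)) = 0 ⇒ Ȟ¹((D₊x₀,D₊x₁); 𝓗om(L, C)) = 0` (tree `CechExactData.sheafHom_of_shortExact`: `𝓗om(L, –)`
  exact for `L` finite locally free).

References (index only): Hartshorne II Ex. 5.1, II Prop. 5.6, III Prop. 6.5 (proof); The Stacks Project, Tag 01ED.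
-/

noncomputable section

-- `TopCat.Presheaf`/`Scheme.Modules` are not reducible (as in Mathlib's `AlgebraicGeometry/Modules`).
set_option backward.isDefEq.respectTransparency false

open CategoryTheory AlgebraicGeometry TopologicalSpace Opposite
open Literature.AlgebraicGeometry.Morphisms Literature.AlgebraicGeometry.Modules Literature.AlgebraicGeometry

attribute [local instance] MvPolynomial.gradedAlgebra Literature.AlgebraicGeometry.Motives.ProjBaseChange.algebraBase

set_option linter.dupNamespace false -- mandated namespace `Summit.<Summit>.<Problem>` of this single-conjunct summit

namespace Summit.ResolutionOfSingularities.ResolutionOfSingularities.Cruxes.EquisingularLiftNat.P1VB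

/-! ### `𝒪_X → 𝓗om(L, L)` is an isomorphism for a line bundle `L` -/

section EndOfLineBundle

variable {X : Scheme.{0}} (L : X.Modules)

/-- The opens carrying a rank-one frame of `L` form a basis of the topology, if every point has one. [folklore] -/
theorem isBasis_frameOpens {I : Type}
    (hL : ∀ x : X, ∃ (W : X.Opens) (_ : x ∈ W), Nonempty (SheafOfModules.free I ≅ L.over W)) :
    Opens.IsBasis {W : X.Opens | Nonempty (SheafOfModules.free I ≅ L.over W)} := by
  refine Opens.isBasis_iff_nbhd.mpr fun {U x} hx => ?_
  obtain ⟨W, hxW, ⟨e⟩⟩ := hL x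
  exact ⟨W ⊓ U, ⟨Motives.SheafOfModules.restrictTrivialisation (R := X.ringCatSheaf) (homOfLE inf_le_left) e⟩,
    ⟨hxW, hx⟩, inf_le_right⟩

/-- **`𝒪_X ≅ 𝓗om(L, L)` for a line bundle**: the unit `a ↦ a · 𝟙` (tree `Modules.sheafHomUnit`) is an isomorphism when `L`
is free of rank one near every point (on a framed open `W`, `End(L|_W) = End(𝒪|_W) = Γ(W, 𝒪)`; bijective on a basis ⇒ iso,
tree `IsoOfSectionsOnBasis`). [folklore] -/
theorem isIso_sheafHomUnit_of_lineBundle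
    (hL : ∀ x : X, ∃ (W : X.Opens) (_ : x ∈ W), Nonempty (SheafOfModules.free (Fin 1) ≅ L.over W)) :
    IsIso (sheafHomUnit L) := by
  refine isIso_of_bijective_on_basis (sheafHomUnit L) (isBasis_frameOpens L hL) fun W ⟨e⟩ => ?_
  have hb : ∀ a : Γ(X, W), appLE (overScalar L W a) (𝟙 W) (basisSection e (0 : Fin 1)) = a • basisSection e (0 : Fin 1) :=
    fun a => by rw [appLE_overScalar, op_id, X.presheaf.map_id]; rfl
  have hcoord : ∀ a : Γ(X, W), coord e (𝟙 W) (a • basisSection e (0 : Fin 1)) (0 : Fin 1) = a := fun a => by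
    rw [coord_smul, coord_basisSection, if_pos rfl, mul_one]
  constructor
  · intro a a' h
    change (sheafHomUnit L).app W a = (sheafHomUnit L).app W a' at h
    rw [sheafHomUnit_app_apply, sheafHomUnit_app_apply] at h
    have h' := congrArg (fun χ : L.over W ⟶ L.over W => coord e (𝟙 W) (appLE χ (𝟙 W) (basisSection e (0 : Fin 1))) (0 : Fin 1)) h
    simp only [hb, hcoord] at h'
    exact h'
  · intro χ
    refine ⟨coord e (𝟙 W) (appLE χ (𝟙 W) (basisSection e (0 : Fin 1))) (0 : Fin 1), ?_⟩
    rw [sheafHomUnit_app_apply]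
    refine hom_ext_of_basisSection e fun i => ?_
    obtain rfl : i = (0 : Fin 1) := Subsingleton.elim _ _
    rw [hb]
    conv_rhs => rw [eq_sum_coord_smul e (𝟙 W) (appLE χ (𝟙 W) (basisSection e (0 : Fin 1)))]
    rw [Fintype.sum_unique, op_id, L.presheaf.map_id]
    rfl

/-- `𝓗om(L, L)` is affine-localizing (quasi-coherent) for a line bundle `L`. [folklore] -/
theorem isAffineLocalizing_sheafHom_self_of_lineBundle
    (hL : ∀ x : X, ∃ (W : X.Opens) (_ : x ∈ W), Nonempty (SheafOfModules.free (Fin 1) ≅ L.over W)) :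
    IsAffineLocalizing (sheafHom L L) :=
  haveI := isIso_sheafHomUnit_of_lineBundle L hL
  IsAffineLocalizing.of_iso (asIso (sheafHomUnit L)) IsAffineLocalizing.unit

end EndOfLineBundle

/-! ### On `ℙ¹_k`: `Ȟ¹(𝓗om(L, L)) = 0` and the transfer to `𝓗om(L, C)` -/

section ProjectiveLine

variable (k : Type) [Field k]

/-- **`Ȟ¹((D₊x₀, D₊x₁); 𝓗om(L, L)) = 0` for a line bundle `L` on `ℙ¹_k`** (`𝓗om(L,L) ≅ 𝒪` and part 8). [folklore] -/
theorem subsingleton_cechMH1_sheafHom_self_projectiveLine (L : (ProjCech.PP k 1).Modules)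
    (hL : ∀ x : ProjCech.PP k 1, ∃ (W : (ProjCech.PP k 1).Opens) (_ : x ∈ W),
      Nonempty (SheafOfModules.free (Fin 1) ≅ L.over W)) :
    Subsingleton (CechMH1 (ProjCech.toSpec k 1) (sheafHom L L) (fun i : Fin 2 => ProjCech.Dplus k 1 {i})) :=
  haveI := isIso_sheafHomUnit_of_lineBundle L hL
  subsingleton_cechMH1_of_iso (ProjCech.toSpec k 1) _ (asIso (sheafHomUnit L)).symm
    (subsingleton_cechMH1_unit_projectiveLine k)

/-- Two-out-of-three for `Ȟ¹ = 0` from sectionwise exactness data (the form produced by the tree's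
`CechExactData.sheafHom_of_shortExact`). [folklore] -/
theorem subsingleton_cechMH1_of_cechExactData {A : Type} [CommRing A] {X : Scheme.{0}} (f : X ⟶ Spec (.of A))
    {ι : Type} (U : ι → X.Opens) {M' M M'' : X.Modules} {φ : M' ⟶ M} {ψ : M ⟶ M''} (hD : CechExactData f U φ ψ)
    (h₁ : Subsingleton (CechMH1 f M' U)) (h₃ : Subsingleton (CechMH1 f M'' U)) : Subsingleton (CechMH1 f M U) := by
  refine ⟨fun y y' => ?_⟩
  suffices h0 : ∀ y : CechMH1 f M U, y = 0 by rw [h0 y, h0 y']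
  intro y
  obtain ⟨z, hz⟩ := hD.exists_cechMapH1_eq y (Subsingleton.elim _ _)
  rw [← hz, Subsingleton.elim z 0, map_zero]

/-- **T-P1VB part 9 — the `Ȟ¹` transfer for a sub-line-bundle on `ℙ¹_k`.** Let `0 → L → C → Q → 0` be a short exact sequence
of `𝒪`-modules on `ℙ¹_k` with `L` a line bundle (free of rank one near every point; e.g. `K₀ ⊆ 𝒞_k` with its rank-one
quotient). If `Ȟ¹((D₊x₀, D₊x₁); 𝓗om(L, Q)) = 0` then `Ȟ¹((D₊x₀, D₊x₁); 𝓗om(L, C)) = 0` — the hypothesis of the lift theorem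
`P1VB.exists_nowhereVanishing_lift_projectiveLine` for `F` with `g^*F ≅ 𝓗om(L, C)`. Proof: `𝓗om(L, –)` is exact (`L` finite
locally free, tree `CechExactData.sheafHom_of_shortExact`), `Ȟ¹(𝓗om(L,L)) = Ȟ¹(𝒪) = 0` (part 8), two-out-of-three. [folklore] -/
theorem subsingleton_cechMH1_sheafHom_of_shortExact_projectiveLine {S : ShortComplex (ProjCech.PP k 1).Modules}
    (hS : S.ShortExact)
    (hL : ∀ x : ProjCech.PP k 1, ∃ (W : (ProjCech.PP k 1).Opens) (_ : x ∈ W),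
      Nonempty (SheafOfModules.free (Fin 1) ≅ S.X₁.over W))
    (hQ : Subsingleton (CechMH1 (ProjCech.toSpec k 1) (sheafHom S.X₁ S.X₃) (fun i : Fin 2 => ProjCech.Dplus k 1 {i}))) :
    Subsingleton (CechMH1 (ProjCech.toSpec k 1) (sheafHom S.X₁ S.X₂) (fun i : Fin 2 => ProjCech.Dplus k 1 {i})) := by
  have hfl : Motives.IsFiniteLocallyFree S.X₁ := fun x => by
    obtain ⟨W, hx, ⟨e⟩⟩ := hL x
    exact ⟨W, hx, Fin 1, inferInstance, ⟨e⟩⟩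
  have hD := CechExactData.sheafHom_of_shortExact (f := ProjCech.toSpec k 1) (U := fun i : Fin 2 => ProjCech.Dplus k 1 {i})
    S.X₁ hfl hS (isAffineLocalizing_sheafHom_self_of_lineBundle S.X₁ hL) (fun i => isAffineOpen_Dplus_singleton k 1 i)
  exact subsingleton_cechMH1_of_cechExactData (ProjCech.toSpec k 1) (fun i : Fin 2 => ProjCech.Dplus k 1 {i}) hD
    (subsingleton_cechMH1_sheafHom_self_projectiveLine k S.X₁ hL) hQ

end ProjectiveLine

end Summit.ResolutionOfSingularities.ResolutionOfSingularities.Cruxes.EquisingularLiftNat.P1VB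

end
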